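import Mathlib
import HarnessLib
import Summits.HubbardSuperconductivity.HubbardSuperconductivity.Theorems.KLProgrammeKLRegimeEngineTwoShellFramePack
import Summits.HubbardSuperconductivity.HubbardSuperconductivity.Theorems.KLProgrammeKLRegimeEngineFrameLevelCount

/-!
# Route `KLProgramme` — ENGINE child (stmt-HubbardSuperconductivity-20437 `KLRegimeEngineV17F2`): the LATTICE two-shell count —
# torus momenta in `{|e_K(p_k̃)| < ε₁} ∩ {|e_K(p_k̃ − p_w̃)| ≤ ε₂}` are controlled by the two-shell AREA package `TwoShellFrameAreaAt`

Cell `gate-hubbard-kl`, seat hubbard-kl-k3c2-p2 g16 (class-#5 STEP supply rows, KLTC-INDEX v10.3 §D «two-shell / floor» [k3c2-p2]).  The engine's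
two-shell package `TwoShellFrameAreaAt A u` (`…EngineV8DefsG11`; inhabited, `twoShellFrameAreaAt_klTS`) is a CONTINUUM statement on the Brillouin
zone, while every class-#5 / value-lane sum runs over the torus momenta `p_k̃ = 2πk̃/L`.  This file is the finite-`L` reading (the empty «lattice»
column of the two-shell row of HOME/hubbard-kl-k3c2-p2/PH-LOOP-SIGNBLIND-INDEX §1): each counted momentum owns the half-open cell `p_k̃ + [0, 2π/L)²`,
on which both shells are fattened by `G·2π/L` (`G` a sup-metric Lipschitz constant of `e_K`); the cells are disjoint and lie in `[0, 2π + 2π/L]²`, which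
NINE `2πℤ²`-translates of the zone `[−π, π)²` cover; the two-shell set is `2πℤ²`-invariant.  Hence

* §1 `card_mul_le_volume_of_cells` — `#P·(2π/L)² ≤ vol S` whenever the cells of the points of `P` lie in `S` (FST II App. B device of
  Literature `LatticeLevelCountFromVolume`, predicate-free form);
* §2 `volume_bigSquare_inter_le_nine_mul` — `vol([0, 2π+δ]² ∩ T) ≤ 9·vol([−π,π)² ∩ T)` for a doubly `2π`-invariant `T` (`δ ≤ 2π`);
* §3 the planar frame band `E(x) = ε(x) − K(x) − μ`: periodicity, sup-metric Lipschitz bound `4 + κ₁` (`abs_frameE_sub_le`), the planar reading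
  `TwoShellFrameAreaAt.volume_planar_le` of the package;
* §4 **`card_twoShell_mul_sq_le`** — for `TwoShellFrameAreaAt A u`, `R.WF2`, `0 < U ≤ u R`, `μ ∈ klWindowC`, `FrameOK R U N μ K`,
  `0 < ε₁ ≤ ε₂`, `ε₂ + G·2π/L ≤ klE0` (`G = 4 + (8/3)·Gfr₁·U²`), a lattice transfer `w̃` with `0 < r ≤ |p_w̃|_𝕋`:
  `#{k̃ : |e_K(p_k̃)| < ε₁ ∧ |e_K(p_{k̃−w̃})| ≤ ε₂}·(2π/L)² ≤ 9·A·(ε₁ + 2πG/L)·((ε₂ + 2πG/L)/r + √(ε₂ + 2πG/L))`, and the package instance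
  `card_twoShell_mul_sq_le_klTS` (`A = klTS`, `u = klTSU`, unconditional).
Everything is PROVED; no definitions, no named facts; nothing asserts any stub or superconductivity.  [cite: FeldmanSalmhoferTrubowitz1998, App. B]
-/

noncomputable section

namespace Summit.HubbardSuperconductivity.HubbardSuperconductivity.Theorems.EngineV8

set_option linter.dupNamespace false -- summit = problem name (single-conjunct summit), D-0017

open Real Set MeasureTheory Finset
open scoped ENNReal
open Literature.MathematicalPhysics.QuantumLattice Literature.Probability.LatticeModels
open Literature.MathematicalPhysics.QuantumLattice.FermiRG
open Summit.HubbardSuperconductivity.HubbardSuperconductivity.Theorems.KLRegimeSplit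
open Summit.HubbardSuperconductivity.HubbardSuperconductivity.Theorems.KLProgrammeLegKernels
open Summit.HubbardSuperconductivity.HubbardSuperconductivity.Theorems.DispersionFlow
open Summit.HubbardSuperconductivity.HubbardSuperconductivity.Theorems.PerturbedFermiCurve

/-! ## §1 Cells: counted torus momenta against the volume of a set containing their cells -/

/-- **Counted momenta against a volume**: if the half-open cell `p_k̃ + [0, 2π/L)²` of every `k̃ ∈ P` lies in `S ⊆ ℝ²`, then
`#P · (2π/L)² ≤ vol S` (the cells are pairwise disjoint, each of volume `(2π/L)²`). [cite: FeldmanSalmhoferTrubowitz1998, App. B] -/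
theorem card_mul_le_volume_of_cells {L : ℕ} [NeZero L] (P : Finset (TorusSite 2 L)) (S : Set (ℝ × ℝ))
    (hcell : ∀ k ∈ P, Ico (latticeMomentum L k 0) (latticeMomentum L k 0 + 2 * π / L) ×ˢ
      Ico (latticeMomentum L k 1) (latticeMomentum L k 1 + 2 * π / L) ⊆ S) :
    (P.card : ℝ≥0∞) * ENNReal.ofReal ((2 * π / L) ^ 2) ≤ volume S := by
  have hL : (0 : ℝ) < L := by exact_mod_cast Nat.pos_of_ne_zero (NeZero.ne L)
  have hh : 0 < 2 * π / L := by positivity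
  set cell : TorusSite 2 L → Set (ℝ × ℝ) := fun k =>
    Ico (latticeMomentum L k 0) (latticeMomentum L k 0 + 2 * π / L) ×ˢ
      Ico (latticeMomentum L k 1) (latticeMomentum L k 1 + 2 * π / L) with hcelldef
  have hlm : ∀ (k : TorusSite 2 L) (i : Fin 2), latticeMomentum L k i = 2 * π * ((k i).val : ℝ) / L := fun k i => rfl
  have step : ∀ {a b : ℕ}, a < b → 2 * π * (a : ℝ) / L + 2 * π / L ≤ 2 * π * (b : ℝ) / L := fun {a b} h => by
    have h1 : (a : ℝ) + 1 ≤ b := by exact_mod_cast h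
    rw [← add_div, div_le_div_iff_of_pos_right hL]; nlinarith [Real.pi_pos]
  have key : ∀ {a b : ℕ}, a ≠ b → Disjoint (Ico (2 * π * (a : ℝ) / L) (2 * π * (a : ℝ) / L + 2 * π / L))
      (Ico (2 * π * (b : ℝ) / L) (2 * π * (b : ℝ) / L + 2 * π / L)) := by
    intro a b hab
    rw [Set.Ico_disjoint_Ico]
    rcases lt_or_gt_of_ne hab with h | h
    · exact (min_le_left _ _).trans ((step h).trans (le_max_right _ _))
    · exact (min_le_right _ _).trans ((step h).trans (le_max_left _ _))
  have hdisj0 : ∀ {k k' : TorusSite 2 L}, k ≠ k' → Disjoint (cell k) (cell k') := by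
    intro k k' hkk'
    have hne : (k 0).val ≠ (k' 0).val ∨ (k 1).val ≠ (k' 1).val := by
      by_contra h
      push Not at h
      exact hkk' (funext fun i => by fin_cases i <;> [exact ZMod.val_injective _ h.1; exact ZMod.val_injective _ h.2])
    simp only [hcelldef, Set.disjoint_prod, hlm]
    rcases hne with h0 | h1
    · exact Or.inl (key h0)
    · exact Or.inr (key h1)
  have hvolcell : ∀ k : TorusSite 2 L, volume (cell k) = ENNReal.ofReal ((2 * π / L) ^ 2) := by
    intro k
    simp only [hcelldef]
    rw [Measure.volume_eq_prod, Measure.prod_prod, Real.volume_Ico, Real.volume_Ico, add_sub_cancel_left,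
      add_sub_cancel_left, ← ENNReal.ofReal_mul hh.le, sq]
  have hdisj : Set.PairwiseDisjoint (↑P : Set (TorusSite 2 L)) cell := fun k _ k' _ hkk' => hdisj0 hkk'
  have hmeas : ∀ k ∈ P, MeasurableSet (cell k) := fun k _ => measurableSet_Ico.prod measurableSet_Ico
  calc ((P.card : ℝ≥0∞)) * ENNReal.ofReal ((2 * π / L) ^ 2)
      = ∑ k ∈ P, volume (cell k) := by
        rw [Finset.sum_congr rfl fun k _ => hvolcell k, Finset.sum_const, nsmul_eq_mul]
    _ = volume (⋃ k ∈ P, cell k) := (measure_biUnion_finset hdisj hmeas).symm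
    _ ≤ volume S := measure_mono (Set.iUnion₂_subset fun k hk => hcell k hk)

/-- Every cell `p_k̃ + [0, 2π/L)²` lies in the big square `[0, 2π + 2π/L]²`. -/
theorem cell_subset_bigSquare {L : ℕ} [NeZero L] (k : TorusSite 2 L) :
    Ico (latticeMomentum L k 0) (latticeMomentum L k 0 + 2 * π / L) ×ˢ Ico (latticeMomentum L k 1) (latticeMomentum L k 1 + 2 * π / L) ⊆
      Icc (0 : ℝ) (2 * π + 2 * π / L) ×ˢ Icc (0 : ℝ) (2 * π + 2 * π / L) := by
  have hL : (0 : ℝ) < L := by exact_mod_cast Nat.pos_of_ne_zero (NeZero.ne L)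
  have hh : 0 < 2 * π / L := by positivity
  have hval : ∀ i : Fin 2, latticeMomentum L k i + 2 * π / L ≤ 2 * π + 2 * π / L := by
    intro i
    have h1 : ((k i).val : ℝ) + 1 ≤ L := by exact_mod_cast ZMod.val_lt (k i)
    have : 2 * π * ((k i).val : ℝ) / L ≤ 2 * π - 2 * π / L := by
      rw [le_sub_iff_add_le, ← add_div, div_le_iff₀ hL]; nlinarith [Real.pi_pos]
    show 2 * π * ((k i).val : ℝ) / L + 2 * π / L ≤ 2 * π + 2 * π / L
    linarith
  have h0 : ∀ i : Fin 2, 0 ≤ latticeMomentum L k i := fun i => show 0 ≤ 2 * π * ((k i).val : ℝ) / L by positivity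
  intro p hp
  simp only [Set.mem_prod, Set.mem_Ico] at hp
  obtain ⟨⟨h1a, h1b⟩, ⟨h2a, h2b⟩⟩ := hp
  exact ⟨⟨(h0 0).trans h1a, h1b.le.trans (hval 0)⟩, ⟨(h0 1).trans h2a, h2b.le.trans (hval 1)⟩⟩

/-- Points of a cell are within `2π/L` of its lattice momentum in the sup metric. -/
theorem dist_le_of_mem_cell {L : ℕ} [NeZero L] (k : TorusSite 2 L) {q : ℝ × ℝ}
    (hq : q ∈ Ico (latticeMomentum L k 0) (latticeMomentum L k 0 + 2 * π / L) ×ˢ Ico (latticeMomentum L k 1) (latticeMomentum L k 1 + 2 * π / L)) :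
    dist q (latticeMomentum L k 0, latticeMomentum L k 1) ≤ 2 * π / L := by
  have hL : (0 : ℝ) < L := by exact_mod_cast Nat.pos_of_ne_zero (NeZero.ne L)
  have hh : 0 < 2 * π / L := by positivity
  simp only [Set.mem_prod, Set.mem_Ico] at hq
  obtain ⟨⟨h1a, h1b⟩, ⟨h2a, h2b⟩⟩ := hq
  rw [Prod.dist_eq, max_le_iff, Real.dist_eq, Real.dist_eq, abs_le, abs_le]
  constructor <;> constructor <;> linarith

/-! ## §2 Nine translates of the zone cover the big square: `vol([0, 2π+δ]² ∩ T) ≤ 9·vol([−π,π)² ∩ T)` for a `2πℤ²`-invariant `T` -/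

/-- A real number of `[0, 2π + δ]`, `δ ≤ 2π`, lies in `[−π, π) + 2πa` for some `a ∈ {0, 1, 2}`. -/
theorem exists_fin_three_sub_mem_Ico {δ : ℝ} (hδ : δ ≤ 2 * π) {t : ℝ} (ht : t ∈ Icc (0 : ℝ) (2 * π + δ)) :
    ∃ a : Fin 3, t - 2 * π * ((a : ℕ) : ℝ) ∈ Ico (-π) π := by
  have hπ := Real.pi_pos
  obtain ⟨h0, h1⟩ := ht
  by_cases ha : t < π
  · exact ⟨0, by simp only [Fin.val_zero, CharP.cast_eq_zero, mul_zero, sub_zero, Set.mem_Ico]; constructor <;> linarith⟩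
  · by_cases hb : t < 3 * π
    · exact ⟨1, by simp only [Fin.val_one, Nat.cast_one, mul_one, Set.mem_Ico]; push Not at ha; constructor <;> linarith⟩
    · exact ⟨2, by simp only [Fin.val_two, Nat.cast_ofNat, Set.mem_Ico]; push Not at hb; constructor <;> nlinarith⟩

/-- **Nine zone translates cover the big square** (for a doubly `2π`-invariant `T` and `δ ≤ 2π`):
`vol([0, 2π+δ]² ∩ T) ≤ 9 · vol({x | x.1, x.2 ∈ [−π, π)} ∩ T)`. -/
theorem volume_bigSquare_inter_le_nine_mul {T : Set (ℝ × ℝ)} (h1 : ∀ p : ℝ × ℝ, (p.1 + 2 * π, p.2) ∈ T ↔ p ∈ T)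
    (h2 : ∀ p : ℝ × ℝ, (p.1, p.2 + 2 * π) ∈ T ↔ p ∈ T) {δ : ℝ} (hδ : δ ≤ 2 * π) :
    volume ((Icc (0 : ℝ) (2 * π + δ) ×ˢ Icc (0 : ℝ) (2 * π + δ)) ∩ T) ≤
      9 * volume ({x : ℝ × ℝ | x.1 ∈ Ico (-π) π ∧ x.2 ∈ Ico (-π) π} ∩ T) := by
  set Z : Set (ℝ × ℝ) := {x : ℝ × ℝ | x.1 ∈ Ico (-π) π ∧ x.2 ∈ Ico (-π) π} ∩ T with hZ
  set V : Fin 3 × Fin 3 → ℝ × ℝ := fun ab => (2 * π * ((ab.1 : ℕ) : ℝ), 2 * π * ((ab.2 : ℕ) : ℝ)) with hV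
  -- invariance of `T` under subtracting `2π·(a, b)`
  have hT1 : ∀ (n : ℕ) (p : ℝ × ℝ), (p.1 - 2 * π * (n : ℝ), p.2) ∈ T ↔ p ∈ T := by
    intro n
    induction n with
    | zero => intro p; simp
    | succ n ih =>
        intro p
        have e : (p.1 - 2 * π * ((n + 1 : ℕ) : ℝ), p.2) = ((p.1 - 2 * π * (n : ℝ)) - 2 * π, p.2) := by push_cast; ext <;> simp; ring
        have h := h1 ((p.1 - 2 * π * (n : ℝ)) - 2 * π, p.2)
        simp only [sub_add_cancel] at h
        rw [e, ← h]; exact ih p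
  have hT2 : ∀ (n : ℕ) (p : ℝ × ℝ), (p.1, p.2 - 2 * π * (n : ℝ)) ∈ T ↔ p ∈ T := by
    intro n
    induction n with
    | zero => intro p; simp
    | succ n ih =>
        intro p
        have e : (p.1, p.2 - 2 * π * ((n + 1 : ℕ) : ℝ)) = (p.1, (p.2 - 2 * π * (n : ℝ)) - 2 * π) := by push_cast; ext <;> simp; ring
        have h := h2 (p.1, (p.2 - 2 * π * (n : ℝ)) - 2 * π)
        simp only [sub_add_cancel] at h
        rw [e, ← h]; exact ih p
  -- the covering
  have hcover : (Icc (0 : ℝ) (2 * π + δ) ×ˢ Icc (0 : ℝ) (2 * π + δ)) ∩ T ⊆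
      ⋃ ab : Fin 3 × Fin 3, (fun x : ℝ × ℝ => x + (-(V ab))) ⁻¹' Z := by
    intro x hx
    obtain ⟨⟨hx1, hx2⟩, hxT⟩ := hx
    obtain ⟨a, ha⟩ := exists_fin_three_sub_mem_Ico hδ hx1
    obtain ⟨b, hb⟩ := exists_fin_three_sub_mem_Ico hδ hx2
    refine Set.mem_iUnion.2 ⟨(a, b), ?_⟩
    have e : x + -(V (a, b)) = (x.1 - 2 * π * ((a : ℕ) : ℝ), x.2 - 2 * π * ((b : ℕ) : ℝ)) := by
      ext <;> simp [hV, sub_eq_add_neg]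
    rw [Set.mem_preimage, e, hZ, Set.mem_inter_iff, Set.mem_setOf_eq]
    exact ⟨⟨ha, hb⟩, (hT2 b (x.1 - 2 * π * ((a : ℕ) : ℝ), x.2)).2 ((hT1 a x).2 hxT)⟩
  calc volume ((Icc (0 : ℝ) (2 * π + δ) ×ˢ Icc (0 : ℝ) (2 * π + δ)) ∩ T)
      ≤ volume (⋃ ab : Fin 3 × Fin 3, (fun x : ℝ × ℝ => x + (-(V ab))) ⁻¹' Z) := measure_mono hcover
    _ ≤ ∑ ab : Fin 3 × Fin 3, volume ((fun x : ℝ × ℝ => x + (-(V ab))) ⁻¹' Z) := measure_iUnion_fintype_le _ _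
    _ = ∑ _ab : Fin 3 × Fin 3, volume Z := Finset.sum_congr rfl fun ab _ => measure_preimage_add_right volume _ Z
    _ = 9 * volume Z := by
        rw [Finset.sum_const, Finset.card_univ, nsmul_eq_mul]
        norm_num

/-! ## §3 The planar frame band `E(x) = ε(x) − K(x) − μ`: periodicity, Lipschitz bound, the planar reading of the package -/

/-- `2πℤ²`-periodicity of the planar frame band `ε − K`. -/
theorem planarBand_periodic (K : TrigPolyC4v) (p : Fin 2 → ℝ) (m : Fin 2 → ℤ) :
    sqDispersion (fun i => p i + 2 * π * m i) + -K.eval (fun i => p i + 2 * π * m i) = sqDispersion p + -K.eval p := by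
  have e : (fun i => p i + 2 * π * (m i : ℝ)) = fun i => p i + (m i : ℝ) * (2 * π) := by funext i; ring
  rw [e, TrigPolyC4v.eval_periodic]
  congr 1
  simp only [sqDispersion, Real.cos_add_int_mul_two_pi]

/-- The first-coordinate shift by `2π` in the `ℝ × ℝ` chart. -/
theorem vec_add_two_pi_fst (x : ℝ × ℝ) (wv : Fin 2 → ℝ) :
    ((![x.1 + 2 * π, x.2] : Fin 2 → ℝ) - wv) = fun i => (![x.1, x.2] - wv) i + 2 * π * ((![1, 0] : Fin 2 → ℤ) i : ℝ) := by
  funext i; fin_cases i <;> simp; ring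

/-- The second-coordinate shift by `2π` in the `ℝ × ℝ` chart. -/
theorem vec_add_two_pi_snd (x : ℝ × ℝ) (wv : Fin 2 → ℝ) :
    ((![x.1, x.2 + 2 * π] : Fin 2 → ℝ) - wv) = fun i => (![x.1, x.2] - wv) i + 2 * π * ((![0, 1] : Fin 2 → ℤ) i : ℝ) := by
  funext i; fin_cases i <;> simp; ring

/-- **The planar two-shell set is `2πℤ²`-invariant** (first coordinate). -/
theorem twoShellPlanar_add_two_pi_fst (μ : ℝ) (K : TrigPolyC4v) (ε₁ ε₂ : ℝ) (wv : Fin 2 → ℝ) (x : ℝ × ℝ) :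
    (x.1 + 2 * π, x.2) ∈ {x : ℝ × ℝ | |sqDispersion ![x.1, x.2] + -K.eval ![x.1, x.2] - μ| < ε₁ ∧
        |sqDispersion (![x.1, x.2] - wv) + -K.eval (![x.1, x.2] - wv) - μ| ≤ ε₂} ↔
      x ∈ {x : ℝ × ℝ | |sqDispersion ![x.1, x.2] + -K.eval ![x.1, x.2] - μ| < ε₁ ∧
        |sqDispersion (![x.1, x.2] - wv) + -K.eval (![x.1, x.2] - wv) - μ| ≤ ε₂} := by
  simp only [Set.mem_setOf_eq]
  have h0 := vec_add_two_pi_fst x (0 : Fin 2 → ℝ)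
  simp only [sub_zero] at h0
  rw [vec_add_two_pi_fst x wv, h0, planarBand_periodic, planarBand_periodic]

/-- **The planar two-shell set is `2πℤ²`-invariant** (second coordinate). -/
theorem twoShellPlanar_add_two_pi_snd (μ : ℝ) (K : TrigPolyC4v) (ε₁ ε₂ : ℝ) (wv : Fin 2 → ℝ) (x : ℝ × ℝ) :
    (x.1, x.2 + 2 * π) ∈ {x : ℝ × ℝ | |sqDispersion ![x.1, x.2] + -K.eval ![x.1, x.2] - μ| < ε₁ ∧
        |sqDispersion (![x.1, x.2] - wv) + -K.eval (![x.1, x.2] - wv) - μ| ≤ ε₂} ↔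
      x ∈ {x : ℝ × ℝ | |sqDispersion ![x.1, x.2] + -K.eval ![x.1, x.2] - μ| < ε₁ ∧
        |sqDispersion (![x.1, x.2] - wv) + -K.eval (![x.1, x.2] - wv) - μ| ≤ ε₂} := by
  simp only [Set.mem_setOf_eq]
  have h0 := vec_add_two_pi_snd x (0 : Fin 2 → ℝ)
  simp only [sub_zero] at h0
  rw [vec_add_two_pi_snd x wv, h0, planarBand_periodic, planarBand_periodic]

/-- The `ℝ × ℝ` chart is an isometry onto the sup norm of `Fin 2 → ℝ`: `‖x⃗ − y⃗‖ = dist x y`. -/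
theorem norm_vec_sub_vec_eq_dist (x y : ℝ × ℝ) : ‖((![x.1, x.2] : Fin 2 → ℝ) - ![y.1, y.2])‖ = dist x y := by
  rw [dist_eq_norm, Prod.norm_def, Pi.norm_def]
  simp [Fin.univ_succ, Finset.sup_insert]

/-- **Sup-metric Lipschitz bound of the planar frame band** from a global bound `‖Dδ_K‖ ≤ κ₁`: at any common shift `wv`,
`|E(x⃗ − wv) − E(y⃗ − wv)| ≤ (4 + κ₁)·dist x y`. -/
theorem abs_planarBand_sub_le {K : TrigPolyC4v} {κ₁ : ℝ} (hκ : ∀ k : Fin 2 → ℝ, ‖fderiv ℝ (fun k : Fin 2 → ℝ => -K.eval k) k‖ ≤ κ₁)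
    (μ : ℝ) (wv : Fin 2 → ℝ) (x y : ℝ × ℝ) :
    |(sqDispersion (![x.1, x.2] - wv) + -K.eval (![x.1, x.2] - wv) - μ) -
        (sqDispersion (![y.1, y.2] - wv) + -K.eval (![y.1, y.2] - wv) - μ)| ≤ (4 + κ₁) * dist x y := by
  have h := abs_frameE_sub_le (K := K) (κ₁ := κ₁) (fun k _ => hκ k) (![x.1, x.2] - wv) (![y.1, y.2] - wv)
  rw [sub_sub_sub_cancel_right, norm_vec_sub_vec_eq_dist] at h
  have e : (sqDispersion (![x.1, x.2] - wv) + -K.eval (![x.1, x.2] - wv) - μ) -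
      (sqDispersion (![y.1, y.2] - wv) + -K.eval (![y.1, y.2] - wv) - μ) =
      (sqDispersion (![x.1, x.2] - wv) + -K.eval (![x.1, x.2] - wv)) - (sqDispersion (![y.1, y.2] - wv) + -K.eval (![y.1, y.2] - wv)) := by
    ring
  rw [e]; exact h

/-- **The planar reading of the two-shell package**: in the `ℝ × ℝ` chart of the zone, for every admissible frame and shells
`0 < ε₁ ≤ ε₂ ≤ klE0`, every planar transfer `wv` with `0 < r ≤ |wv|_𝕋`,
`vol{x ∈ [−π,π)² : |E(x⃗)| < ε₁ ∧ |E(x⃗ − wv)| ≤ ε₂} ≤ A·ε₁·(ε₂/r + √ε₂)`. -/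
theorem TwoShellFrameAreaAt.volume_planar_le {A : ℝ} {u : RenConsts → ℝ} (h : TwoShellFrameAreaAt A u) {R : RenConsts} (hR : R.WF2)
    {U : ℝ} (hU : 0 < U) (hUu : U ≤ u R) {μ : ℝ} (hμ : μ ∈ klWindowC) {N : ℕ} {K : TrigPolyC4v} (hK : FrameOK R U N μ K)
    {ε₁ ε₂ : ℝ} (hε₁ : 0 < ε₁) (h12 : ε₁ ≤ ε₂) (h2 : ε₂ ≤ klE0) (wv : Fin 2 → ℝ) {r : ℝ} (hr : 0 < r)
    (hrw : r ≤ torusSupNorm (wv 0, wv 1)) :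
    volume {x : ℝ × ℝ | (x.1 ∈ Ico (-π) π ∧ x.2 ∈ Ico (-π) π) ∧
        |sqDispersion ![x.1, x.2] + -K.eval ![x.1, x.2] - μ| < ε₁ ∧
        |sqDispersion (![x.1, x.2] - wv) + -K.eval (![x.1, x.2] - wv) - μ| ≤ ε₂} ≤
      ENNReal.ofReal (A * ε₁ * (ε₂ / r + Real.sqrt ε₂)) := by
  set w : Momentum := WithLp.toLp 2 wv with hwdef
  have hw : (![w 0, w 1] : Fin 2 → ℝ) = wv := by
    funext i; fin_cases i <;> rfl
  have hvol := h R hR U hU hUu μ hμ N K hK ε₁ ε₂ hε₁ h12 h2 w r hr hrw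
  rw [twoShell_frameLevel_eq_preimage μ K ε₁ ε₂ w, hw,
    measurePreserving_momentum_prod.measure_preimage (measurableSet_twoShell_planar μ K ε₁ ε₂ wv).nullMeasurableSet] at hvol
  exact hvol

/-! ## §4 The lattice two-shell count -/

/-- Lattice momenta of a difference: `p_{k̃ − w̃} = p_k̃ − p_w̃ + 2π·z`, `z ∈ ℤ²`. -/
theorem latticeMomentum_sub_eq {L : ℕ} [NeZero L] (k w : TorusSite 2 L) :
    ∃ z : Fin 2 → ℤ, latticeMomentum L (k - w) = fun i => (latticeMomentum L k i - latticeMomentum L w i) + 2 * π * (z i : ℝ) := by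
  have hL : (L : ℝ) ≠ 0 := by exact_mod_cast NeZero.ne L
  have hdvd : ∀ i : Fin 2, ∃ z : ℤ, ((((k - w) i).val : ℕ) : ℤ) - ((((k i).val : ℕ) : ℤ) - (((w i).val : ℕ) : ℤ)) = L * z := by
    intro i
    have h0 : (((((( k - w) i).val : ℕ) : ℤ) - ((((k i).val : ℕ) : ℤ) - (((w i).val : ℕ) : ℤ)) : ℤ) : ZMod L) = 0 := by
      push_cast
      simp
    exact (ZMod.intCast_zmod_eq_zero_iff_dvd _ L).1 h0
  choose z hz using hdvd
  refine ⟨z, funext fun i => ?_⟩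
  have hi : ((((k - w) i).val : ℕ) : ℝ) = (((k i).val : ℕ) : ℝ) - (((w i).val : ℕ) : ℝ) + (L : ℝ) * (z i : ℝ) := by
    have := hz i
    have h' : (((((k - w) i).val : ℕ) : ℤ) : ℝ) = (((((k i).val : ℕ) : ℤ) - (((w i).val : ℕ) : ℤ) + L * z i : ℤ) : ℝ) := by
      rw [← this]; push_cast; ring
    push_cast at h'
    exact h'
  simp only [latticeMomentum, hi]
  field_simp

/-- The torus band in the `ℝ × ℝ` chart: `e_K(p_k̃) = E(p_k̃)`. -/
theorem nambuXiCT_eq_planarBand {L : ℕ} [NeZero L] (μ : ℝ) (K : TrigPolyC4v) (k : TorusSite 2 L) :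
    nambuXiCT L μ K k = sqDispersion ![latticeMomentum L k 0, latticeMomentum L k 1] + -K.eval ![latticeMomentum L k 0, latticeMomentum L k 1] - μ := by
  rw [nambuXiCT_eq_frameLevel L μ K k, frameLevel_eq_planar]

/-- The torus band at a difference in the `ℝ × ℝ` chart: `e_K(p_{k̃−w̃}) = E(p_k̃ − p_w̃)`. -/
theorem nambuXiCT_sub_eq_planarBand {L : ℕ} [NeZero L] (μ : ℝ) (K : TrigPolyC4v) (k w : TorusSite 2 L) :
    nambuXiCT L μ K (k - w) = sqDispersion (![latticeMomentum L k 0, latticeMomentum L k 1] - latticeMomentum L w) +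
      -K.eval (![latticeMomentum L k 0, latticeMomentum L k 1] - latticeMomentum L w) - μ := by
  obtain ⟨z, hz⟩ := latticeMomentum_sub_eq k w
  rw [nambuXiCT_eq_planarBand]
  have e : (![latticeMomentum L (k - w) 0, latticeMomentum L (k - w) 1] : Fin 2 → ℝ) =
      fun i => (![latticeMomentum L k 0, latticeMomentum L k 1] - latticeMomentum L w) i + 2 * π * (z i : ℝ) := by
    funext i; fin_cases i <;> simp [hz]
  rw [e, planarBand_periodic]

/-- **THE LATTICE TWO-SHELL COUNT.**  For a two-shell area package `TwoShellFrameAreaAt A u` (`0 ≤ A`), `R.WF2`, `0 < U ≤ u R`, `μ ∈ klWindowC`, an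
admissible frame `FrameOK R U N μ K`, shells `0 < ε₁ ≤ ε₂` with `ε₂ + G·2π/L ≤ klE0` (`G = 4 + (8/3)·Gfr₁·U²`, a sup-metric Lipschitz constant of `e_K`), and a
lattice transfer `w̃` at torus distance `≥ r > 0`:
`#{k̃ : |e_K(p_k̃)| < ε₁ ∧ |e_K(p_{k̃−w̃})| ≤ ε₂} · (2π/L)² ≤ 9·A·(ε₁ + G·2π/L)·((ε₂ + G·2π/L)/r + √(ε₂ + G·2π/L))`.
[cite: FeldmanSalmhoferTrubowitz1998, App. B] -/
theorem card_twoShell_mul_sq_le {A : ℝ} {u : RenConsts → ℝ} (h : TwoShellFrameAreaAt A u) (hA : 0 ≤ A) {R : RenConsts} (hR : R.WF2)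
    {U : ℝ} (hU : 0 < U) (hUu : U ≤ u R) {μ : ℝ} (hμ : μ ∈ klWindowC) {N : ℕ} {K : TrigPolyC4v} (hK : FrameOK R U N μ K)
    {L : ℕ} [NeZero L] {ε₁ ε₂ : ℝ} (hε₁ : 0 < ε₁) (h12 : ε₁ ≤ ε₂)
    (h2 : ε₂ + (4 + 8 / 3 * R.Gfr 1 * U ^ 2) * (2 * π / L) ≤ klE0) (wt : TorusSite 2 L) {r : ℝ} (hr : 0 < r) (hrw : r ≤ klTorusNorm L wt) :
    ((univ.filter fun k : TorusSite 2 L => |nambuXiCT L μ K k| < ε₁ ∧ |nambuXiCT L μ K (k - wt)| ≤ ε₂).card : ℝ) * (2 * π / L) ^ 2 ≤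
      9 * (A * (ε₁ + (4 + 8 / 3 * R.Gfr 1 * U ^ 2) * (2 * π / L)) *
        ((ε₂ + (4 + 8 / 3 * R.Gfr 1 * U ^ 2) * (2 * π / L)) / r + Real.sqrt (ε₂ + (4 + 8 / 3 * R.Gfr 1 * U ^ 2) * (2 * π / L)))) := by
  have hπ := Real.pi_pos
  have hL : (0 : ℝ) < L := by exact_mod_cast Nat.pos_of_ne_zero (NeZero.ne L)
  have hGfr : ∀ j, 0 ≤ R.Gfr j := hR.wf.2.2
  set G : ℝ := 4 + 8 / 3 * R.Gfr 1 * U ^ 2 with hG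
  have hG0 : 0 ≤ G := by rw [hG]; nlinarith [hGfr 1, sq_nonneg U]
  set δ : ℝ := 2 * π / L with hδ
  have hδ0 : 0 < δ := by rw [hδ]; positivity
  have h1L : (1 : ℝ) ≤ L := by exact_mod_cast Nat.one_le_iff_ne_zero.2 (NeZero.ne L)
  have hδ2π : δ ≤ 2 * π := by rw [hδ, div_le_iff₀ hL]; nlinarith
  set wv : Fin 2 → ℝ := latticeMomentum L wt with hwv
  -- the fattened shells
  set ε₁' : ℝ := ε₁ + G * δ with hε₁'
  set ε₂' : ℝ := ε₂ + G * δ with hε₂'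
  have hε₁'0 : 0 < ε₁' := by rw [hε₁']; positivity
  have h12' : ε₁' ≤ ε₂' := by rw [hε₁', hε₂']; linarith
  -- the Lipschitz bound of the planar band
  have hκ : ∀ k : Fin 2 → ℝ, ‖fderiv ℝ (fun k : Fin 2 → ℝ => -K.eval k) k‖ ≤ 8 / 3 * R.Gfr 1 * U ^ 2 :=
    fun k => norm_fderiv_negEval_le_of_frameOK hGfr hK k
  -- the fattened planar two-shell set and the target set
  set T : Set (ℝ × ℝ) := {x : ℝ × ℝ | |sqDispersion ![x.1, x.2] + -K.eval ![x.1, x.2] - μ| < ε₁' ∧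
      |sqDispersion (![x.1, x.2] - wv) + -K.eval (![x.1, x.2] - wv) - μ| ≤ ε₂'} with hT
  set S : Set (ℝ × ℝ) := (Icc (0 : ℝ) (2 * π + δ) ×ˢ Icc (0 : ℝ) (2 * π + δ)) ∩ T with hS
  set P := univ.filter fun k : TorusSite 2 L => |nambuXiCT L μ K k| < ε₁ ∧ |nambuXiCT L μ K (k - wt)| ≤ ε₂ with hP
  -- step 1: the cells of the counted momenta lie in `S`
  have hcell : ∀ k ∈ P, Ico (latticeMomentum L k 0) (latticeMomentum L k 0 + 2 * π / L) ×ˢ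
      Ico (latticeMomentum L k 1) (latticeMomentum L k 1 + 2 * π / L) ⊆ S := by
    intro k hk q hq
    obtain ⟨hk1, hk2⟩ := (Finset.mem_filter.1 hk).2
    refine ⟨cell_subset_bigSquare k hq, ?_⟩
    have hd : dist q (latticeMomentum L k 0, latticeMomentum L k 1) ≤ δ := dist_le_of_mem_cell k hq
    have hGd : G * dist q (latticeMomentum L k 0, latticeMomentum L k 1) ≤ G * δ := mul_le_mul_of_nonneg_left hd hG0
    rw [nambuXiCT_eq_planarBand] at hk1
    rw [nambuXiCT_sub_eq_planarBand] at hk2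
    have l1 := abs_planarBand_sub_le hκ μ 0 q (latticeMomentum L k 0, latticeMomentum L k 1)
    have l2 := abs_planarBand_sub_le hκ μ wv q (latticeMomentum L k 0, latticeMomentum L k 1)
    simp only [sub_zero] at l1
    rw [← hG] at l1 l2
    refine ⟨?_, ?_⟩
    · have t := abs_sub_abs_le_abs_sub (sqDispersion ![q.1, q.2] + -K.eval ![q.1, q.2] - μ)
        (sqDispersion ![latticeMomentum L k 0, latticeMomentum L k 1] + -K.eval ![latticeMomentum L k 0, latticeMomentum L k 1] - μ)
      show |sqDispersion ![q.1, q.2] + -K.eval ![q.1, q.2] - μ| < ε₁'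
      rw [hε₁']; linarith
    · have t := abs_sub_abs_le_abs_sub (sqDispersion (![q.1, q.2] - wv) + -K.eval (![q.1, q.2] - wv) - μ)
        (sqDispersion (![latticeMomentum L k 0, latticeMomentum L k 1] - wv) + -K.eval (![latticeMomentum L k 0, latticeMomentum L k 1] - wv) - μ)
      show |sqDispersion (![q.1, q.2] - wv) + -K.eval (![q.1, q.2] - wv) - μ| ≤ ε₂'
      rw [hε₂']; linarith
  -- step 2: cells, covering, package
  have step1 := card_mul_le_volume_of_cells P S hcell
  have step2 : volume S ≤ 9 * volume ({x : ℝ × ℝ | x.1 ∈ Ico (-π) π ∧ x.2 ∈ Ico (-π) π} ∩ T) :=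
    volume_bigSquare_inter_le_nine_mul (twoShellPlanar_add_two_pi_fst μ K ε₁' ε₂' wv) (twoShellPlanar_add_two_pi_snd μ K ε₁' ε₂' wv) hδ2π
  have hZ : ({x : ℝ × ℝ | x.1 ∈ Ico (-π) π ∧ x.2 ∈ Ico (-π) π} ∩ T) =
      {x : ℝ × ℝ | (x.1 ∈ Ico (-π) π ∧ x.2 ∈ Ico (-π) π) ∧
        |sqDispersion ![x.1, x.2] + -K.eval ![x.1, x.2] - μ| < ε₁' ∧
        |sqDispersion (![x.1, x.2] - wv) + -K.eval (![x.1, x.2] - wv) - μ| ≤ ε₂'} := by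
    ext x; simp only [hT, Set.mem_inter_iff, Set.mem_setOf_eq]
  have hrw' : r ≤ torusSupNorm (wv 0, wv 1) := by rw [hwv]; exact hrw
  have step3 := h.volume_planar_le hR hU hUu hμ hK hε₁'0 h12' (by rw [hε₂']; exact h2) wv hr hrw'
  rw [← hZ] at step3
  -- assemble in `ℝ≥0∞`, then read in `ℝ`
  have hB : 0 ≤ A * ε₁' * (ε₂' / r + Real.sqrt ε₂') := by
    have : 0 ≤ ε₂' := hε₁'0.le.trans h12'
    positivity
  have hfin : (P.card : ℝ≥0∞) * ENNReal.ofReal (δ ^ 2) ≤ ENNReal.ofReal (9 * (A * ε₁' * (ε₂' / r + Real.sqrt ε₂'))) := by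
    calc (P.card : ℝ≥0∞) * ENNReal.ofReal (δ ^ 2) ≤ volume S := step1
      _ ≤ 9 * volume ({x : ℝ × ℝ | x.1 ∈ Ico (-π) π ∧ x.2 ∈ Ico (-π) π} ∩ T) := step2
      _ ≤ 9 * ENNReal.ofReal (A * ε₁' * (ε₂' / r + Real.sqrt ε₂')) := by gcongr
      _ = ENNReal.ofReal (9 * (A * ε₁' * (ε₂' / r + Real.sqrt ε₂'))) := by
          rw [ENNReal.ofReal_mul (by norm_num : (0 : ℝ) ≤ 9), ENNReal.ofReal_ofNat]
  rw [show (P.card : ℝ≥0∞) * ENNReal.ofReal (δ ^ 2) = ENNReal.ofReal ((P.card : ℝ) * δ ^ 2) by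
    rw [ENNReal.ofReal_mul (Nat.cast_nonneg _), ENNReal.ofReal_natCast], ENNReal.ofReal_le_ofReal_iff (by positivity)] at hfin
  exact hfin

/-- **The package instance** (`A = klTS`, `u = klTSU`, unconditional by `twoShellFrameAreaAt_klTS`): for `R.WF2`, `0 < U ≤ klTSU R`, `μ ∈ klWindowC`,
`FrameOK R U N μ K`, `0 < ε₁ ≤ ε₂`, `ε₂ + G·2π/L ≤ klE0`, `0 < r ≤ |p_w̃|_𝕋`:
`#{k̃ : |e_K(p_k̃)| < ε₁ ∧ |e_K(p_{k̃−w̃})| ≤ ε₂}·(2π/L)² ≤ 9·klTS·(ε₁ + G·2π/L)·((ε₂ + G·2π/L)/r + √(ε₂ + G·2π/L))`. -/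
theorem card_twoShell_mul_sq_le_klTS {R : RenConsts} (hR : R.WF2) {U : ℝ} (hU : 0 < U) (hUu : U ≤ klTSU R) {μ : ℝ} (hμ : μ ∈ klWindowC)
    {N : ℕ} {K : TrigPolyC4v} (hK : FrameOK R U N μ K) {L : ℕ} [NeZero L] {ε₁ ε₂ : ℝ} (hε₁ : 0 < ε₁) (h12 : ε₁ ≤ ε₂)
    (h2 : ε₂ + (4 + 8 / 3 * R.Gfr 1 * U ^ 2) * (2 * π / L) ≤ klE0) (wt : TorusSite 2 L) {r : ℝ} (hr : 0 < r) (hrw : r ≤ klTorusNorm L wt) :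
    ((univ.filter fun k : TorusSite 2 L => |nambuXiCT L μ K k| < ε₁ ∧ |nambuXiCT L μ K (k - wt)| ≤ ε₂).card : ℝ) * (2 * π / L) ^ 2 ≤
      9 * (klTS * (ε₁ + (4 + 8 / 3 * R.Gfr 1 * U ^ 2) * (2 * π / L)) *
        ((ε₂ + (4 + 8 / 3 * R.Gfr 1 * U ^ 2) * (2 * π / L)) / r + Real.sqrt (ε₂ + (4 + 8 / 3 * R.Gfr 1 * U ^ 2) * (2 * π / L)))) :=
  card_twoShell_mul_sq_le twoShellFrameAreaAt_klTS klTS_nonneg hR hU hUu hμ hK hε₁ h12 h2 wt hr hrw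

end Summit.HubbardSuperconductivity.HubbardSuperconductivity.Theorems.EngineV8

end
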